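import Summits.ResolutionOfSingularities.ResolutionOfSingularities.Theorems.SatelliteTransport2
import HarnessLib

/-!
# SatelliteCutCells — decomp-res node «SatelliteCut» (lens-4 g28, critic row 164), tree file 4/5 of the node

Content VERBATIM from the decomp-res lens-4 g28 node `HOME/decomp-res-lens-4/g28/SatelliteCut.lean` (pin b83bf2f8 =
`parts/SatelliteCut-g28-b83bf2f8.lean`,
998 l; HOME = run/shared/lean/pub/decomp-res): ONE NEW PART §74–§77 = `parts/part_new-g28-3bc4b3a5.lean` (46
declarations), typed against the LANDED
tree (the node imports `Theorems/DepthCutCells` + `Theorems/MaxContactCutCompanionCut` only; nothing carried, nothing inlined).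
Critic: CRITIC-LEDGER row 164 (2026-08-31T01:23:24Z): CLEARED — DECIDED +1 · MAP 0 (the SATELLITE NO-JUMP LAW over
two consecutive blow-ups =
Hauser's kangaroo condition (3) in kernel, unconditional in the shallow prime-weight window; typed sub-cell `n.Prime
∧ SatelliteJumpTower n` of
`NoWildShallowCompanionKangarooTowers` EMPTY for every `n`; EXACT hypothesis-free re-location to
`NoWildFreeJumpShallowCompanionKangarooTowers`; entrances
on both sides; census cross-check T-satellite (census-1 g23, `HOME/census/it/kangsat/T-satellite.md` 2d03875b)
confirmed 2/2 · 33/33 · 0/88).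
Landing orders INBOX :651 (lens-4 g28 landing note, split per NEXT-g29 §3) and :659 (critic): `--kind proof
--supports stmt-ResolutionOfSingularities-28338`,
namespace `…Theorems.HugValuationCut`, canonical headers, one file per section (D-0064); files of the node:
`SatelliteAlgebra` (§74) · `SatelliteTransport` + `SatelliteTransport2` (§75) ·
`SatelliteCutCells` (§76–§77, cone-free cells: the aside home) · `MaxContactCutSatelliteCut` (the four §77
corollaries GIVEN 31571 `MaxContactCut.NoContactHuggingTowers`
BY NAME — in the Theses cone, kept apart so that the route file can import the aside home without an import cycle,
as for `DepthCutCells` / `MaxContactCutDepthCut`).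
Aside bookkeeping (row 164 / INBOX :659): ONE successor aside on the lens-4 column,
`NoWildFreeJumpShallowCompanionKangarooTowers` (home `SatelliteCutCells`),
SUPERSEDING g27's `NoWildShallowCompanionKangarooTowers` (exact hyp-free
`noWildShallowCompanionKangarooTowers_iff_g28`); the decided cell
`NoWildSatelliteJumpShallowTowers` is a THEOREM (`noWildSatelliteJumpShallowTowers_holds`) and is not filed.  TWO
TEXT FIXES at landing (docstrings only, ordered by
the critic, row 164 / INBOX :659; no statement or proof changed): (i) the hand inhabitant in the docstring of
`WildFreeJumpShallowCompanionKangarooTowersTerminate`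
is NODE-g28's isolated chain `Z² + U³ + U²T + T⁵ → z² + u²t + u³t + t³ → (z₁ + t)² + tv² + vt² + v²t² + v³t²` (the
lens text named a non-isolated polynomial);
(ii) the part's declaration count «42» → 46.

## This file

§76 (NEW, KERNEL) THE SATELLITE LAW ALONG `ForcedTower` — `section SatelliteTowers`: `eTail_succ_of_pwInv`,
`wInv_succ_of_eTail_satellite`, THE LAW **`wInv_of_satellite_window`** (PWInv at `i` along `H` ∧ WInv at `i+1` along
`H′` ∧ `x_{i+2}` on the strict transform of the stage-`i` exceptional component ⟹ WInv at `i+2` along `H″` —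
Hauser's kangaroo condition (3) in kernel), `jump_point_is_free`, the typed sub-cell `SatelliteJumpTower n T`,
`no_satelliteJumpTower`; §77 (cells, EXACT, hypothesis-free) — `section SatelliteCells` minus the four `h71`
corollaries (those are the wiring file `MaxContactCutSatelliteCut`): the decided cell
`WildSatelliteJumpShallowCompanionKangarooTowersTerminate` / the located residual
`WildFreeJumpShallowCompanionKangarooTowersTerminate`, `noTowerWild_satelliteJump_holds`,
`wildSatelliteJumpShallow_holds` (EVERY `n`), the split and the EXACT hyp-free
`wildShallowCompanionKangaroo_iff_g28`, the cells by name `NoWildSatelliteJumpShallowTowers` (DECIDED: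
`noWildSatelliteJumpShallowTowers_holds`) and **`NoWildFreeJumpShallowCompanionKangarooTowers`** (THE LOCATED
RESIDUAL — the ONE successor aside on the lens-4 column, superseding g27's `NoWildShallowCompanionKangarooTowers`),
the EXACT hyp-free re-locations `noWildShallowCompanionKangarooTowers_iff_g28` / `_iff_satellite_and_free` /
`noWildCompanionKangarooTowers_iff_g28`, and the up-links `…_of_g27` / `…_of_aside` / `noWildShallow…_of_free`.
Cone-free (importable by the route file: aside home).  Imports `SatelliteTransport2` (hence `SatelliteTransport`,
`DepthCutCells`).

[WRITER NOTE (decomp-res writer g10): file split only (tree files ≤ 400 lines); namespace, universes, sections,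
section variables and every declaration
exactly as in the lens (the node's global `set_option` and the `open …Theses` line live only in the wiring file; the
pure-algebra file opens only what it uses).]

(Sources: Hauser2010Kangaroo (arXiv:0811.4151 p. 6, Kangaroo Theorem condition (3) + remark (a)); HauserPerlega2019
§2; Hauser2024 PRIMS 60; Moh1987; Matsumura1987 Thms. 14.2–14.3; ZariskiSamuel1960 VIII §11; StacksProject Tag 00NQ;
CossartPiltant2008 §2; Giraud1975.)
-/

noncomputable section

open CategoryTheory AlgebraicGeometry IsLocalRing
open Literature.AlgebraicGeometry.Resolution
open Summit.ResolutionOfSingularities.ResolutionOfSingularities.Theorems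
open WeakOrderReduction ForcedTowerClasses DivergentTowerClasses MonomialTowerClasses
open HugDimensionClasses HugDimensionKernels SurfaceShadowClasses SurfaceShadowKernels
open NearPointCut (SingularClass)
open AbsoluteContactClasses (IsAbsContactAt SepResidueAt diffIdeal_restrict_le stalkMap_comp_toStalk_eq_stalkHom)
open scoped BigOperators

namespace Summit.ResolutionOfSingularities.ResolutionOfSingularities.Theorems.HugValuationCut

section SatelliteTowers

variable {k : Type} [Field k]

/-! ## §76 (g28 · NEW · KERNEL) THE SATELLITE LAW ALONG lens-4's `ForcedTower`, the typed sub-cell `SatelliteJumpTower`, the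
cut of g27's located residual and its EXACT hypothesis-free re-location BY NAME -/

/-- **TRANSPORT WITH MEMORY ALONG THE TOWER (KERNEL, PROVED)**: principal weak contact at stage `i` along `H` and NO jump at
stage `i + 1` ⟹ `ETail` at stage `i + 1` along the strict transform of `H`, with the exceptional divisor `E_{i+1} =
π_i^{-1}(x_i)`
as the remembered factor. (Sources: Hauser2010Kangaroo; EncinasVillamayor2000, Thm. 4.9.) -/
theorem eTail_succ_of_pwInv (T : ForcedTower) (g : T.St 0 ⟶ Spec (.of k)) (hB : IsBase (T.St 0) g) {n : ℕ}
    (hn : 1 ≤ n) (hD : IsDatum n (T.D 0)) (i : ℕ) (H : (T.St i).IdealSheafData) (h : PWInv (T.D i).ideal H n (T.pt i))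
    (h' : WInv (T.D (i + 1)).ideal (strictTransformIdeal (T.π i) (T.centre i) H) n (T.pt (i + 1))) :
    ETail (T.D (i + 1)).ideal (strictTransformIdeal (T.π i) (T.centre i) H) ((T.centre i).comap (T.π i)) n (T.pt (i + 1)) := by
  obtain ⟨hNi, hRi⟩ := tower_isLocallyNoetherian_isRegular T g hB i
  obtain ⟨hNi1, -⟩ := tower_isLocallyNoetherian_isRegular T g hB (i + 1)
  haveI := hNi
  haveI := hNi1
  have hπ := T.isBlowup i
  have hy : (T.π i).base (T.pt (i + 1)) = T.pt i := T.pt_map i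
  have hDi1 : (T.D (i + 1)).ideal = controlledTransform (T.π i) (T.centre i) (T.D i).ideal n := by
    rw [T.transform_eq i, MarkedIdeal.transform_ideal, tower_mult_eq T hD i]
  rw [hDi1] at h' ⊢
  have h0 : PWInv (T.D i).ideal H n ((T.π i).base (T.pt (i + 1))) := by rw [hy]; exact h
  have hIn : stalkIdeal (T.D i).ideal ((T.π i).base (T.pt (i + 1))) ≤ maximalIdeal _ ^ n := by
    rw [hy]; exact tower_stalkIdeal_le_pow T hD i
  have hI'n : stalkIdeal (controlledTransform (T.π i) (T.centre i) (T.D i).ideal n) (T.pt (i + 1)) ≤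
      maximalIdeal _ ^ n := by
    have h1 := tower_stalkIdeal_le_pow T hD (i + 1)
    rw [hDi1] at h1
    exact h1
  have hpt' : ((T.centre i).support : Set (T.St i)) = {(T.π i).base (T.pt (i + 1))} := by
    rw [hy]; exact T.centre_support i
  have hcl : IsClosed ({(T.π i).base (T.pt (i + 1))} : Set (T.St i)) := by rw [hy]; exact T.isClosed_pt i
  exact eTail_point_transport hπ hRi (T.centre_regular i) _ H hn _ hcl hpt' hIn hI'n h0 h'

/-- **THE SATELLITE LAW ALONG THE TOWER, ONE STEP (KERNEL, PROVED, weight = characteristic = `p`, every field)**: at a stage `i`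
of a `p`-POWER tower of weight `p` carrying `ETail` along `(H, E)`, if the next marked point is a SATELLITE point
for `E` (lies on
the strict transform of `E`) then there is NO JUMP at stage `i + 1` along the strict transform of `H`.
(Sources: Hauser2010Kangaroo; Moh1987; HauserPerlega2019, §2.) -/
theorem wInv_succ_of_eTail_satellite {p : ℕ} (hp : p.Prime) [CharP k p] (T : ForcedTower) (g : T.St 0 ⟶ Spec (.of k))
    (hB : IsBase (T.St 0) g) (hD : IsDatum p (T.D 0)) (hP : PPowerTower p T) (i : ℕ) (H E : (T.St i).IdealSheafData)
    (h : ETail (T.D i).ideal H E p (T.pt i))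
    (hsat : T.pt (i + 1) ∈ ((strictTransformIdeal (T.π i) (T.centre i) E).support : Set (T.St (i + 1)))) :
    WInv (T.D (i + 1)).ideal (strictTransformIdeal (T.π i) (T.centre i) H) p (T.pt (i + 1)) := by
  haveI := Fact.mk hp
  obtain ⟨hNi, hRi⟩ := tower_isLocallyNoetherian_isRegular T g hB i
  obtain ⟨hNi1, -⟩ := tower_isLocallyNoetherian_isRegular T g hB (i + 1)
  haveI := hNi
  haveI := hNi1
  haveI hchar : CharP ((T.St (i + 1)).presheaf.stalk (T.pt (i + 1))) p := charP_stalk_stage T g (i + 1)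
  have hπ := T.isBlowup i
  have hy : (T.π i).base (T.pt (i + 1)) = T.pt i := T.pt_map i
  have hDi1 : (T.D (i + 1)).ideal = controlledTransform (T.π i) (T.centre i) (T.D i).ideal p := by
    rw [T.transform_eq i, MarkedIdeal.transform_ideal, tower_mult_eq T hD i]
  obtain ⟨-, hle⟩ := hP (i + 1) p hp hchar
  rw [Nat.div_self hp.pos, pow_one] at hle
  rw [hDi1] at hle ⊢
  have h0 : ETail (T.D i).ideal H E p ((T.π i).base (T.pt (i + 1))) := by rw [hy]; exact h
  have hIn : stalkIdeal (T.D i).ideal ((T.π i).base (T.pt (i + 1))) ≤ maximalIdeal _ ^ p := by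
    rw [hy]; exact tower_stalkIdeal_le_pow T hD i
  have hI'1 : stalkIdeal (controlledTransform (T.π i) (T.centre i) (T.D i).ideal p) (T.pt (i + 1)) ≤
      maximalIdeal _ := by
    have h1 := tower_stalkIdeal_le_pow T hD (i + 1)
    rw [hDi1] at h1
    exact h1.trans (Ideal.pow_le_self hp.ne_zero)
  have hpt' : ((T.centre i).support : Set (T.St i)) = {(T.π i).base (T.pt (i + 1))} := by
    rw [hy]; exact T.centre_support i
  have hcl : IsClosed ({(T.π i).base (T.pt (i + 1))} : Set (T.St i)) := by rw [hy]; exact T.isClosed_pt i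
  exact wInv_of_eTail_satellite hπ hRi (T.centre_regular i) _ H E _ hcl hpt' hIn hI'1 h0 hsat Set.Subset.rfl hle

/-- **THE SATELLITE NO-JUMP LAW OVER TWO CONSECUTIVE BLOW-UPS (KERNEL, PROVED, weight = characteristic = `p`, every field)**:
along a `p`-power forced tower of weight `p`, if stage `i` has PRINCIPAL weak contact along `H`, stage `i + 1` has NO jump along
`H'`, and the marked point `x_{i+2}` is a SATELLITE point of the second blow-up — it lies on the strict transform of the
exceptional divisor `E_{i+1} = π_i^{-1}(x_i)` — then stage `i + 2` has NO jump along `H''`.  Hauser's kangaroo condition (3)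
(arXiv:0811.4151, §C: «none of the exceptional components through the antelope point with residue in `[1, p−1]` passes through
the kangaroo point») in kernel form, UNCONDITIONAL in g27's shallow window: the component `E_{i+1}` always has residue
`N − p ∈ [1, p − 1]` there, so a jump point is never on its transform. (Sources: Hauser2010Kangaroo; HauserPerlega2019, §2;
Moh1987.) -/
theorem wInv_of_satellite_window {p : ℕ} (hp : p.Prime) [CharP k p] (T : ForcedTower) (g : T.St 0 ⟶ Spec (.of k))
    (hB : IsBase (T.St 0) g) (hD : IsDatum p (T.D 0)) (hP : PPowerTower p T) (i : ℕ) (H : (T.St i).IdealSheafData)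
    (h0 : PWInv (T.D i).ideal H p (T.pt i))
    (h1 : WInv (T.D (i + 1)).ideal (strictTransformIdeal (T.π i) (T.centre i) H) p (T.pt (i + 1)))
    (hsat : T.pt (i + 2) ∈ ((strictTransformIdeal (T.π (i + 1)) (T.centre (i + 1)) ((T.centre i).comap (T.π i))).support :
      Set (T.St (i + 2)))) :
    WInv (T.D (i + 2)).ideal
      (strictTransformIdeal (T.π (i + 1)) (T.centre (i + 1)) (strictTransformIdeal (T.π i) (T.centre i) H)) p (T.pt (i + 2)) :=
  wInv_succ_of_eTail_satellite hp T g hB hD hP (i + 1) _ _ (eTail_succ_of_pwInv T g hB hp.one_lt.le hD i H h0 h1) hsat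

/-- **THE LOCATION LAW (KERNEL, PROVED)**: along a weight-`p` `p`-power forced tower, a kangaroo jump at stage `i + 2` after a
principal weak-contact stage `i` and a jump-free stage `i + 1` happens at a point FREE of the old exceptional
component: `x_{i+2}`
is NOT on the strict transform of `E_{i+1}`. (Sources: Hauser2010Kangaroo; HauserPerlega2019, §2.) -/
theorem jump_point_is_free {p : ℕ} (hp : p.Prime) [CharP k p] (T : ForcedTower) (g : T.St 0 ⟶ Spec (.of k))
    (hB : IsBase (T.St 0) g) (hD : IsDatum p (T.D 0)) (hP : PPowerTower p T) (i : ℕ) (H : (T.St i).IdealSheafData)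
    (h0 : PWInv (T.D i).ideal H p (T.pt i))
    (h1 : WInv (T.D (i + 1)).ideal (strictTransformIdeal (T.π i) (T.centre i) H) p (T.pt (i + 1)))
    (hjump : ¬ WInv (T.D (i + 2)).ideal
      (strictTransformIdeal (T.π (i + 1)) (T.centre (i + 1)) (strictTransformIdeal (T.π i) (T.centre i) H)) p (T.pt (i + 2))) :
    T.pt (i + 2) ∉ ((strictTransformIdeal (T.π (i + 1)) (T.centre (i + 1)) ((T.centre i).comap (T.π i))).support :
      Set (T.St (i + 2))) :=
  fun hsat => hjump (wInv_of_satellite_window hp T g hB hD hP i H h0 h1 hsat)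

/-- **`SatelliteJumpTower n T` — A KANGAROO JUMP AT A SATELLITE POINT** (NEW TYPED SUB-CELL PREDICATE, two consecutive blow-ups
and the jump letter load-bearing): some stage `i` has principal weak contact of weight `n` along a germ `H`, stage
`i + 1` has no
jump along `H'`, the marked point `x_{i+2}` lies on the strict transform of `E_{i+1}`, and weak contact along `H''` FAILS at
`x_{i+2}`.  DEFINITION (support). -/
def SatelliteJumpTower (n : ℕ) (T : ForcedTower) : Prop :=
  ∃ (i : ℕ) (H : (T.St i).IdealSheafData),
    PWInv (T.D i).ideal H n (T.pt i) ∧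
      WInv (T.D (i + 1)).ideal (strictTransformIdeal (T.π i) (T.centre i) H) n (T.pt (i + 1)) ∧
        T.pt (i + 2) ∈ ((strictTransformIdeal (T.π (i + 1)) (T.centre (i + 1)) ((T.centre i).comap (T.π i))).support :
          Set (T.St (i + 2))) ∧
          ¬ WInv (T.D (i + 2)).ideal
            (strictTransformIdeal (T.π (i + 1)) (T.centre (i + 1)) (strictTransformIdeal (T.π i) (T.centre i) H)) n
            (T.pt (i + 2))

/-- **LAW BY NAME (KERNEL, PROVED, every field of characteristic `p`): NO weight-`p` `p`-POWER FORCED TOWER HAS A SATELLITE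
JUMP.** [folklore] -/
theorem no_satelliteJumpTower {p : ℕ} (hp : p.Prime) [CharP k p] (T : ForcedTower) (g : T.St 0 ⟶ Spec (.of k))
    (hB : IsBase (T.St 0) g) (hD : IsDatum p (T.D 0)) (hP : PPowerTower p T) : ¬ SatelliteJumpTower p T := by
  rintro ⟨i, H, h0, h1, hsat, hjump⟩
  exact jump_point_is_free hp T g hB hD hP i H h0 h1 hjump hsat

end SatelliteTowers

section SatelliteCells

/-! ## §77 (g28 · NEW) THE CUT OF THE g27 LOCATED RESIDUAL BY THE SATELLITE LAW — cells and EXACT re-locations BY NAME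

`WildShallowCompanionKangarooTowersTerminate n` (g27's located residual) ⟺ (SATELLITE-JUMP bed at PRIME weight — DECIDED,
EMPTY in kernel: `wildSatelliteJumpShallow_holds`) ∧ (FREE-JUMP shallow residual — THE LOCATED RESIDUAL after g28: in addition,
at prime weight NO jump of the tower is a satellite jump: after every principal no-jump window the jump point is FREE of the
previous exceptional component).  The re-location `wildShallowCompanionKangaroo_iff_g28` is HYPOTHESIS-FREE. -/

/-- **CELL (g27 residual ∧ prime weight ∧ SATELLITE JUMP)** — DECIDED: EMPTY by the satellite law (`no_satelliteJumpTower`,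
`p = n` forced by `p ∣ n`, `n` prime); ENTRANCE inhabited (char 2, weight 2, `d = 3`): `z² + u³ + v⁵` → (`v`-chart)
`z'² + u'³v + v³` (no jump, tail `∈ (v)`) → (`u'`-chart origin, a SATELLITE point: on the strict transform `{v'' = 0}` of `E₁`)
`z''² + u'v''(u' + v''²)` — isolated order-2 points throughout, and NO jump at the satellite point, as the law dictates. -/
def WildSatelliteJumpShallowCompanionKangarooTowersTerminate (n : ℕ) : Prop :=
  NoTowerWild n fun T =>
    (((((SingularClass T ∧ Nonempty (MarkedShadow T n)) ∧ PPowerTower n T) ∧ ¬ EventuallyJumpFree n T) ∧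
      ¬ EventuallyCompanionJumpFree n T) ∧ ¬ DeepTower n T) ∧ (n.Prime ∧ SatelliteJumpTower n T)

/-- **CELL (g27 residual ∧ ¬(prime weight ∧ satellite jump)) · THE LOCATED RESIDUAL after g28** — UNDECIDED · IDEA-NEEDED:
wild, off-locus singular class, `p`-power form at every marked point, weight-`n` kangaroo-recurrent, companion-recurrent,
shallow, and — at prime weight `n = p` — FREE-JUMPING: no jump at a satellite point after a principal no-jump window (every
kangaroo jump regains contact at a point off the old exceptional components).  Census profile: all 382 `(2,2)` kangO chains and
the 51 recurrent `(2,4)` chains (composite weight: the clause is void); hand inhabitant of the entrance (char 2,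
NODE-g28's chain):
`Z² + U³ + U²T + T⁵` → (`T`-chart) `z² + u²t + u³t + t³` (no jump) → (`t`-chart at `u/t = 1`, FREE of `E₁'`)
`(z₁ + t)² + tv² + vt² + v²t² + v³t²`: a jump. -/
def WildFreeJumpShallowCompanionKangarooTowersTerminate (n : ℕ) : Prop :=
  NoTowerWild n fun T =>
    (((((SingularClass T ∧ Nonempty (MarkedShadow T n)) ∧ PPowerTower n T) ∧ ¬ EventuallyJumpFree n T) ∧
      ¬ EventuallyCompanionJumpFree n T) ∧ ¬ DeepTower n T) ∧ ¬ (n.Prime ∧ SatelliteJumpTower n T)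

/-- **KERNEL (PROVED, every class, every `n`): THE PRIME-WEIGHT SATELLITE-JUMP COLUMN OF EVERY WILD `p`-POWER CLASS IS EMPTY**
— the general form of the cut, applicable verbatim to every other lens's `p`-power tower residual. [folklore] -/
theorem noTowerWild_satelliteJump_holds (n : ℕ) (P : ForcedTower → Prop) (hPP : ∀ T, P T → PPowerTower n T) :
    NoTowerWild n fun T => P T ∧ (n.Prime ∧ SatelliteJumpTower n T) := by
  intro p hp hpn k _ _ T g hB hD _ hT
  obtain ⟨hPT, hn, hsat⟩ := hT
  have hpn' : p = n := (Nat.prime_dvd_prime_iff_eq hp hn).mp hpn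
  subst hpn'
  exact no_satelliteJumpTower hp T g hB hD (hPP T hPT) hsat

/-- **KERNEL (pure logic): every class splits EXACTLY by `n.Prime ∧ SatelliteJumpTower n`.** [folklore] -/
theorem noTowerWild_split_satellite {n : ℕ} (P : ForcedTower → Prop) :
    NoTowerWild n P ↔ NoTowerWild n (fun T => P T ∧ (n.Prime ∧ SatelliteJumpTower n T)) ∧
      NoTowerWild n (fun T => P T ∧ ¬ (n.Prime ∧ SatelliteJumpTower n T)) :=
  noTowerWild_split _ _

/-- **DECIDED (KERNEL, PROVED, every `n`, every field): THE SATELLITE-JUMP CELL IS EMPTY.** [folklore] -/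
theorem wildSatelliteJumpShallow_holds (n : ℕ) : WildSatelliteJumpShallowCompanionKangarooTowersTerminate n :=
  noTowerWild_satelliteJump_holds n _ fun _ hT => hT.1.1.1.2

/-- **EXACT (pure logic): the g27 located residual = the satellite-jump bed ∧ the free-jump residual.** [folklore] -/
theorem wildShallowCompanionKangaroo_split_g28 (n : ℕ) :
    WildShallowCompanionKangarooTowersTerminate n ↔
      WildSatelliteJumpShallowCompanionKangarooTowersTerminate n ∧ WildFreeJumpShallowCompanionKangarooTowersTerminate n :=
  noTowerWild_split _ _

/-- **EXACT RE-LOCATION, HYPOTHESIS-FREE (KERNEL, PROVED): the g27 located residual ⟺ THE FREE-JUMP SHALLOW RESIDUAL.**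
[folklore] -/
theorem wildShallowCompanionKangaroo_iff_g28 (n : ℕ) :
    WildShallowCompanionKangarooTowersTerminate n ↔ WildFreeJumpShallowCompanionKangarooTowersTerminate n :=
  ⟨fun h => ((wildShallowCompanionKangaroo_split_g28 n).mp h).2,
    fun h => (wildShallowCompanionKangaroo_split_g28 n).mpr ⟨wildSatelliteJumpShallow_holds n, h⟩⟩

/-- the free-jump residual is a sub-residual of g27's, g26's (hypothesis-free). [folklore] -/
theorem wildFreeJumpShallow_of_g26 {n : ℕ} (hn : 1 ≤ n) (h : WildCompanionKangarooTowersTerminate n) :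
    WildFreeJumpShallowCompanionKangarooTowersTerminate n :=
  (wildShallowCompanionKangaroo_iff_g28 n).mp ((wildCompanionKangaroo_iff_g27 hn).mp h)

/-- BY NAME: **no wild SATELLITE-JUMPING shallow tower** (DECIDED: PROVED). -/
def NoWildSatelliteJumpShallowTowers : Prop := ∀ n : ℕ, 1 ≤ n → WildSatelliteJumpShallowCompanionKangarooTowersTerminate n

/-- BY NAME: **no wild FREE-JUMPING shallow companion-recurrent tower** — THE LOCATED RESIDUAL of the aside chain
`NoWildContactFreeOffLocusTowers ⊇ NoWildPPowerOffLocusTowers ⊇ NoWildKangarooOffLocusTowers ⊇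
NoWildKangarooOffDoublePointTowers ⊇
NoWildCompanionKangarooTowers ⊇ NoWildShallowCompanionKangarooTowers ⊇ ·` after g28. -/
def NoWildFreeJumpShallowCompanionKangarooTowers : Prop :=
  ∀ n : ℕ, 1 ≤ n → WildFreeJumpShallowCompanionKangarooTowersTerminate n

/-- **DECIDED BY NAME (KERNEL, PROVED).** [folklore] -/
theorem noWildSatelliteJumpShallowTowers_holds : NoWildSatelliteJumpShallowTowers := fun n _ =>
  wildSatelliteJumpShallow_holds n

/-- **EXACT RE-LOCATION BY NAME, HYPOTHESIS-FREE: the g27 residual ⟺ the free-jump residual.** [folklore] -/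
theorem noWildShallowCompanionKangarooTowers_iff_g28 :
    NoWildShallowCompanionKangarooTowers ↔ NoWildFreeJumpShallowCompanionKangarooTowers :=
  ⟨fun h n hn => (wildShallowCompanionKangaroo_iff_g28 n).mp (h n hn),
    fun h n hn => (wildShallowCompanionKangaroo_iff_g28 n).mpr (h n hn)⟩

/-- **EXACT BY NAME as a conjunction (satellite ∧ free), hypothesis-free.** [folklore] -/
theorem noWildShallowCompanionKangarooTowers_iff_satellite_and_free :
    NoWildShallowCompanionKangarooTowers ↔ NoWildSatelliteJumpShallowTowers ∧ NoWildFreeJumpShallowCompanionKangarooTowers :=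
  ⟨fun h => ⟨noWildSatelliteJumpShallowTowers_holds, noWildShallowCompanionKangarooTowers_iff_g28.mp h⟩,
    fun h => noWildShallowCompanionKangarooTowers_iff_g28.mpr h.2⟩

/-- **EXACT RE-LOCATION BY NAME, HYPOTHESIS-FREE: the g26 residual ⟺ the free-jump residual.** [folklore] -/
theorem noWildCompanionKangarooTowers_iff_g28 : NoWildCompanionKangarooTowers ↔ NoWildFreeJumpShallowCompanionKangarooTowers := by
  rw [noWildCompanionKangarooTowers_iff_g27, noWildShallowCompanionKangarooTowers_iff_g28]

/-- up-link (hypothesis-free direction): the g28 residual ⟸ the g27 residual. [folklore] -/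
theorem noWildFreeJumpShallowCompanionKangarooTowers_of_g27 (h : NoWildShallowCompanionKangarooTowers) :
    NoWildFreeJumpShallowCompanionKangarooTowers :=
  noWildShallowCompanionKangarooTowers_iff_g28.mp h

/-- up-link from the g26 residual (hypothesis-free). [folklore] -/
theorem noWildFreeJumpShallowCompanionKangarooTowers_of_g26 (h : NoWildCompanionKangarooTowers) :
    NoWildFreeJumpShallowCompanionKangarooTowers :=
  noWildCompanionKangarooTowers_iff_g28.mp h

/-- up-link from the TREE aside `NoWildContactFreeOffLocusTowers` (hypothesis-free). [folklore] -/
theorem noWildFreeJumpShallowCompanionKangarooTowers_of_aside (h : NoWildContactFreeOffLocusTowers) :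
    NoWildFreeJumpShallowCompanionKangarooTowers :=
  noWildFreeJumpShallowCompanionKangarooTowers_of_g27 (noWildShallowCompanionKangarooTowers_of_aside h)

end SatelliteCells

end Summit.ResolutionOfSingularities.ResolutionOfSingularities.Theorems.HugValuationCut
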